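import Literature.NumberTheory.GaloisRepresentations.LubinTateColemanCoordMomentsLinearTwo
import HarnessLib

/-!
# The moments of the Coleman coordinate module IN COORDINATES (`q = 2`): for `r = c₀ • 1 + c₁ • σ_{−1}(1)` (the `Λ[Δ]`-basis),
# `mom_k(r) = (c₀(γ^{k+1} − 1) + (−1)^{k+1} c₁(γ^{k+1} − 1)) · mom_k(1)`; the values `mom_0 = ` augmentation, `mom_{k+1}(1) = u⁻¹·[X⁰]D_E^[k] ω_E`

De Shalit, *Iwasawa theory of elliptic curves with complex multiplication* (1987), Ch. I §3.1 ("`ℤ_p⟦𝒢⟧ = Λ[Δ]` … `u^α ↦ (1+S)^α`"), §3.5 (11)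
(i)–(ii), §3.7 (`𝒰 ≅ Λ₁ ⊆ Λ(𝒢)`): an element of the Iwasawa algebra `Λ(𝒢) = Λ[Δ]` (`𝒢 = Δ × Γ`, `Δ = {±1}` at `p = 2`) is read at the character
`κ^{k+1}` as `G₊(κ(γ)^{k+1} − 1) + κ(−1)^{k+1}·G₋(κ(γ)^{k+1} − 1)` (Washington §12.2/§13.2: `∫ κ^s dν = G(κ(γ)^s − 1)` for `γ ↦ 1 + T`).  On the
Coleman-series side at `q = 2` the coordinate module `M = ColemanCoordModule` IS `Λ·1 ⊕ Λ·σ_{−1}(1)` (`coordBasisDelta`,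
`LubinTateColemanCoordModuleTwo`), and `LubinTateColemanCoordMomentsLinearTwo` proved that the moment functionals `mom_k` are `Λ`-linear
(`coordMoment_smul`) and `Δ`-equivariant (`coordMoment_unitTwistₗ`).  THIS file writes the moments in the two bases and computes the
universal values (everything PROVED, 0 sorry, no definitions):

* §1 ★★ `coordMoment_eq_repr_coordBasisDelta` — **`mom_k(r) = (c₀(a_k) + (−1)^{k+1}·c₁(a_k)) · mom_k(1)`**, `a_k = γ^{k+1} − 1`,
  `(c₀, c₁) = coordBasisDelta.repr r` — the moment of an element of `M ≅ Λ[Δ]` is its `Λ[Δ]`-coordinate READ AT THE CHARACTER `κ^{k+1}`, times the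
  universal constant `mom_k(1)`; and `coordMoment_eq_repr_coordBasis` — `mom_k(r) = c₀′(a_k)·mom_k(1) + c₁′(a_k)·mom_k(Y)` in the basis `{1, Y}`;
* §2 the universal values: ★ `coordMoment_zero_eq_constantCoeff` (**`mom_0(r) = r(0)`**: the weight-one moment is the augmentation; so
  `mom_0(1) = 1`, `mom_0(Y) = 0`), `coordToKer_one` (`Φ(1) = 1 + u⁻¹X`), ★ `coordMoment_succ_one` (**`mom_{k+1}(1) = u⁻¹ · [X⁰] D_E^[k] ω_E`**,
  `ω_E` the relative invariant differential), `coordMoment_one_one` (`mom_1(1) = u⁻¹`, a unit);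
* §3 consequences for the `Λ[Δ]`-structure: `coordMoment_eq_zero_of_repr` (if `c₀(a_k) + (−1)^{k+1}c₁(a_k) = 0` then `mom_k(r) = 0`),
  `coordMoment_smul_one` / `coordMoment_smul_unitTwistₗ_neg_one_one` (the two generators: `mom_k(c • 1) = c(a_k)·mom_k(1)`,
  `mom_k(c • σ_{−1}(1)) = (−1)^{k+1} c(a_k)·mom_k(1)`).

This is the coordinate half of the junction (J-i) of the Coleman lane with de Shalit's measure `i(β)`: the measure lane reads the SAME numbers
as `∫ κ^{k+1} d i(β) = ε^k·Θ(j(mom_k(r_β)))` (socket `constantCoeff_mahlerD_iterate_subst_compSeriesC_map` + `coordMoment_relUnitCoordTwo`), so the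
`Λ[Δ]`-coordinates `(c₀, c₁)` of `Col β` determine every moment of `i(β)` through `c₀(a_k) ± c₁(a_k)`.

## References
* E. de Shalit, *Iwasawa theory of elliptic curves with complex multiplication* (1987), Ch. I §3.1, §3.4 Lemma (ii), §3.5 (11) (i)–(ii), §3.7.
  [deShalit1987]
* L. C. Washington, *Introduction to Cyclotomic Fields*, 2nd ed. (1997), §12.2, §13.2. [Washington1997]
-/

noncomputable section

open PowerSeries

namespace Literature.NumberTheory.GaloisRepresentations

section CoordMomentsBasisTwo

open GaloisRepresentations.IsNonarchimedeanLocalField LubinTate ValuativeRel Field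

variable {F : Type} [Field F] [ValuativeRel F] [TopologicalSpace F] [IsNonarchimedeanLocalField F]

attribute [local instance] ltNormUniformSpace ltNormIsUniformAddGroup rk1 nF nE fintypeResidueField

variable {π : 𝒪[F]} (hπ : (valuation F).IsUniformizer (π : F))
variable (E : IntermediateField F (AlgebraicClosure F)) [FiniteDimensional F E]
variable (hq : residueFieldCard F = 2) (u : (LTCoeff F)ˣ) (hu : LTCoeff.of F π = residueFieldCard F * u) (γ : 𝒪[F]ˣ)

/-! ### §2 (first, no completeness needed). The universal values `mom_0 = ` augmentation, `mom_{k+1}(1)` -/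

/-- **`Φ(1) = 1 + u⁻¹X`** (`1 ∘ f = 1`). [cite: deShalit1987, Ch. I §3.7] -/
theorem coordToKer_one :
    coordToKer hπ E u 1 = 1 + PowerSeries.C (algebraMap (LTCoeff F) (unitBall E) (↑u⁻¹ : LTCoeff F)) * PowerSeries.X := by
  have hs : PowerSeries.HasSubst ((ltSer F π).map (algebraMap (LTCoeff F) (unitBall E))) :=
    PowerSeries.HasSubst.of_constantCoeff_zero' ((isLTSeries_ltSer π).map _).constantCoeff_eq_zero
  rw [coordToKer, ← PowerSeries.coe_substAlgHom hs, map_one, mul_one]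

/-- `Φ(r)(0) = r(0)` (`f(0) = 0`, `(1 + u⁻¹X)(0) = 1`). [cite: deShalit1987, Ch. I §3.7] -/
theorem constantCoeff_coordToKer (r : PowerSeries (unitBall E)) :
    PowerSeries.constantCoeff (coordToKer hπ E u r) = PowerSeries.constantCoeff r := by
  rw [coordToKer, map_mul, map_add, map_one, map_mul, PowerSeries.constantCoeff_C, PowerSeries.constantCoeff_X, mul_zero, add_zero, one_mul,
    constantCoeff_subst_eq ((isLTSeries_ltSer π).map (algebraMap (LTCoeff F) (unitBall E))).constantCoeff_eq_zero]

/-- ★ **`mom_0(r) = r(0)`**: the weight-one moment functional is the AUGMENTATION of the coordinate module. [cite: deShalit1987, Ch. I §3.5 (11)] -/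
theorem coordMoment_zero_eq_constantCoeff (r : PowerSeries (unitBall E)) :
    coordMoment hπ E u 0 r = PowerSeries.constantCoeff r := by
  unfold coordMoment
  rw [Function.iterate_zero_apply, constantCoeff_coordToKer]

/-- `mom_0(1) = 1`. [cite: deShalit1987, Ch. I §3.5 (11)] -/
theorem coordMoment_zero_one : coordMoment hπ E u 0 1 = 1 := by
  rw [coordMoment_zero_eq_constantCoeff, map_one]

/-- `mom_0(Y) = 0`. [cite: deShalit1987, Ch. I §3.5 (11)] -/
theorem coordMoment_zero_X : coordMoment hπ E u 0 PowerSeries.X = 0 := by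
  rw [coordMoment_zero_eq_constantCoeff, PowerSeries.constantCoeff_X]

/-- `D_E(Φ 1) = u⁻¹ · ω_E` (`d/dX (1 + u⁻¹X) = u⁻¹`). [cite: deShalit1987, Ch. I §3.5] -/
theorem relDerivation_coordToKer_one :
    (invDiff (isLTRing_LTCoeff hπ) (isLTSeries_LTCoeff π)).map (algebraMap (LTCoeff F) (unitBall E)) * d⁄dX (unitBall E) (coordToKer hπ E u 1) =
      PowerSeries.C (algebraMap (LTCoeff F) (unitBall E) (↑u⁻¹ : LTCoeff F)) *
        (invDiff (isLTRing_LTCoeff hπ) (isLTSeries_LTCoeff π)).map (algebraMap (LTCoeff F) (unitBall E)) := by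
  rw [coordToKer_one, map_add, Derivation.map_one_eq_zero, zero_add, ← PowerSeries.smul_eq_C_mul, Derivation.map_smul, PowerSeries.derivative_X,
    PowerSeries.smul_eq_C_mul, mul_one, mul_comm]

/-- ★ **`mom_{k+1}(1) = u⁻¹ · [X⁰] D_E^[k] ω_E`** — the universal values of the moments on the generator `1` of `M` (`D_E(1 + u⁻¹X) = u⁻¹ω_E`).
[cite: deShalit1987, Ch. I §3.5 (11)] -/
theorem coordMoment_succ_one (k : ℕ) :
    coordMoment hπ E u (k + 1) 1 =
      algebraMap (LTCoeff F) (unitBall E) (↑u⁻¹ : LTCoeff F) *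
        PowerSeries.constantCoeff ((fun g : PowerSeries (unitBall E) =>
          (invDiff (isLTRing_LTCoeff hπ) (isLTSeries_LTCoeff π)).map (algebraMap (LTCoeff F) (unitBall E)) * d⁄dX (unitBall E) g)^[k]
            ((invDiff (isLTRing_LTCoeff hπ) (isLTSeries_LTCoeff π)).map (algebraMap (LTCoeff F) (unitBall E)))) := by
  unfold coordMoment
  rw [Function.iterate_succ_apply, relDerivation_coordToKer_one, iterate_derivation_C_mul, map_mul, PowerSeries.constantCoeff_C]

/-- **`mom_1(1) = u⁻¹`** (`ω_E(0) = 1`): a unit — the weight-two moment functional does not vanish on the generator. [cite: deShalit1987, Ch. I §3.5 (11)] -/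
theorem coordMoment_one_one : coordMoment hπ E u 1 1 = algebraMap (LTCoeff F) (unitBall E) (↑u⁻¹ : LTCoeff F) := by
  rw [coordMoment_succ_one, Function.iterate_zero_apply, ← PowerSeries.coeff_zero_eq_constantCoeff_apply, PowerSeries.coeff_map,
    PowerSeries.coeff_zero_eq_constantCoeff_apply, constantCoeff_invDiff, map_one, mul_one]

/-! ### §1. The moments in the bases `{1, σ_{−1}(1)}` and `{1, Y}` -/

variable [IsAdicComplete (Ideal.span {algebraMap (LTCoeff F) (unitBall E) (LTCoeff.of F π)}) (unitBall E)]

include hu in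
/-- **`mom_k(c • 1) = c(a_k) · mom_k(1)`**, `a_k = γ^{k+1} − 1`. [cite: deShalit1987, Ch. I §3.5 (ii)] -/
theorem coordMoment_smul_one (k : ℕ) (c : PowerSeries (unitBall E)) :
    coordMoment hπ E u k (TActModule.toPS (c • (TActModule.ofPS (twistLinearBase hπ hq (algebraMap (LTCoeff F) (unitBall E)) u γ)
      (twistLinearBase_mem_adicFiltGen_succ hπ hq (algebraMap (LTCoeff F) (unitBall E)) u hu γ) 1))) =
      tEval (algebraMap_unit_pow_sub_one_mem hπ E hq γ k) c * coordMoment hπ E u k 1 := by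
  rw [coordMoment_smul hπ E hq u hu γ, TActModule.toPS_ofPS]

include hu in
/-- **`mom_k(σ_{−1}(1)) = (−1)^{k+1} · mom_k(1)`**. [cite: deShalit1987, Ch. I §3.4 Lemma (ii), §3.5 (ii)] -/
theorem coordMoment_unitTwistₗ_neg_one_one (k : ℕ) :
    coordMoment hπ E u k (TActModule.toPS (unitTwistₗ hπ hq (algebraMap (LTCoeff F) (unitBall E)) u hu γ (-1) (TActModule.ofPS _ _ 1))) =
      (-1) ^ (k + 1) * coordMoment hπ E u k 1 := by
  rw [coordMoment_unitTwistₗ hπ E hq u hu γ, TActModule.toPS_ofPS, Units.val_neg, Units.val_one, map_neg, map_one]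

include hu in
/-- **`mom_k(c • σ_{−1}(1)) = (−1)^{k+1} · c(a_k) · mom_k(1)`**. [cite: deShalit1987, Ch. I §3.4 Lemma (ii), §3.5 (ii)] -/
theorem coordMoment_smul_unitTwistₗ_neg_one_one (k : ℕ) (c : PowerSeries (unitBall E)) :
    coordMoment hπ E u k (TActModule.toPS (c • unitTwistₗ hπ hq (algebraMap (LTCoeff F) (unitBall E)) u hu γ (-1) (TActModule.ofPS _ _ 1))) =
      (-1) ^ (k + 1) * tEval (algebraMap_unit_pow_sub_one_mem hπ E hq γ k) c * coordMoment hπ E u k 1 := by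
  rw [coordMoment_smul hπ E hq u hu γ, coordMoment_unitTwistₗ_neg_one_one hπ E hq u hu γ]
  ring

variable (hreg : ∀ x : unitBall E, algebraMap (LTCoeff F) (unitBall E) (LTCoeff.of F π) * x = 0 → x = 0)
  (w : 𝒪[F]ˣ) (hγ : (γ : 𝒪[F]) = 1 + π ^ 2 * w)

include hu in
/-- ★★ **THE MOMENTS IN THE `Λ[Δ]`-BASIS**: for `r = c₀ • 1 + c₁ • σ_{−1}(1)` (`(c₀, c₁) = coordBasisDelta.repr r`),
**`mom_k(r) = (c₀(a_k) + (−1)^{k+1}·c₁(a_k)) · mom_k(1)`**, `a_k = γ^{k+1} − 1` — the `Λ[Δ]`-coordinate of `r` read at the character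
`κ^{k+1}` (`T ↦ κ(γ)^{k+1} − 1`, `[−1] ↦ κ(−1)^{k+1}`). [cite: deShalit1987, Ch. I §3.1, §3.5 (11) (ii)] [cite: Washington1997, §13.2] -/
theorem coordMoment_eq_repr_coordBasisDelta (k : ℕ) (r : ColemanCoordModule hπ hq (algebraMap (LTCoeff F) (unitBall E)) u hu γ) :
    coordMoment hπ E u k (TActModule.toPS r) =
      (tEval (algebraMap_unit_pow_sub_one_mem hπ E hq γ k)
          ((coordBasisDelta hπ hq (algebraMap (LTCoeff F) (unitBall E)) u hu γ hreg w hγ).repr r 0) +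
        (-1) ^ (k + 1) * tEval (algebraMap_unit_pow_sub_one_mem hπ E hq γ k)
          ((coordBasisDelta hπ hq (algebraMap (LTCoeff F) (unitBall E)) u hu γ hreg w hγ).repr r 1)) *
        coordMoment hπ E u k 1 := by
  conv_lhs => rw [eq_repr_zero_smul_one_add_repr_one_smul hπ hq (algebraMap (LTCoeff F) (unitBall E)) u hu γ hreg w hγ r]
  rw [map_add, coordMoment_add, coordMoment_smul_one hπ E hq u hu γ, coordMoment_smul_unitTwistₗ_neg_one_one hπ E hq u hu γ]
  ring

/-- Every element is `c₀′ • 1 + c₁′ • Y` in the basis `{1, Y}` (`coordBasis`), module form. [cite: deShalit1987, Ch. I §3.1] -/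
theorem eq_repr_coordBasis_zero_smul_one_add_repr_one_smul_X (r : ColemanCoordModule hπ hq (algebraMap (LTCoeff F) (unitBall E)) u hu γ) :
    r = (coordBasis hπ hq (algebraMap (LTCoeff F) (unitBall E)) u hu γ hreg w hγ).repr r 0 • TActModule.ofPS _ _ 1 +
      (coordBasis hπ hq (algebraMap (LTCoeff F) (unitBall E)) u hu γ hreg w hγ).repr r 1 • TActModule.ofPS _ _ PowerSeries.X := by
  conv_lhs => rw [← (coordBasis hπ hq (algebraMap (LTCoeff F) (unitBall E)) u hu γ hreg w hγ).sum_repr r]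
  rw [Fin.sum_univ_two, coordBasis_zero, coordBasis_one]

include hu in
/-- **`mom_k(c • Y) = c(a_k) · mom_k(Y)`**. [cite: deShalit1987, Ch. I §3.5 (ii)] -/
theorem coordMoment_smul_X (k : ℕ) (c : PowerSeries (unitBall E)) :
    coordMoment hπ E u k (TActModule.toPS (c • (TActModule.ofPS (twistLinearBase hπ hq (algebraMap (LTCoeff F) (unitBall E)) u γ)
      (twistLinearBase_mem_adicFiltGen_succ hπ hq (algebraMap (LTCoeff F) (unitBall E)) u hu γ) PowerSeries.X))) =
      tEval (algebraMap_unit_pow_sub_one_mem hπ E hq γ k) c * coordMoment hπ E u k PowerSeries.X := by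
  rw [coordMoment_smul hπ E hq u hu γ, TActModule.toPS_ofPS]

include hu in
/-- **THE MOMENTS IN THE BASIS `{1, Y}`**: `mom_k(r) = c₀′(a_k)·mom_k(1) + c₁′(a_k)·mom_k(Y)`, `(c₀′, c₁′) = coordBasis.repr r`.
[cite: deShalit1987, Ch. I §3.1, §3.5 (11) (ii)] -/
theorem coordMoment_eq_repr_coordBasis (k : ℕ) (r : ColemanCoordModule hπ hq (algebraMap (LTCoeff F) (unitBall E)) u hu γ) :
    coordMoment hπ E u k (TActModule.toPS r) =
      tEval (algebraMap_unit_pow_sub_one_mem hπ E hq γ k)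
          ((coordBasis hπ hq (algebraMap (LTCoeff F) (unitBall E)) u hu γ hreg w hγ).repr r 0) * coordMoment hπ E u k 1 +
        tEval (algebraMap_unit_pow_sub_one_mem hπ E hq γ k)
          ((coordBasis hπ hq (algebraMap (LTCoeff F) (unitBall E)) u hu γ hreg w hγ).repr r 1) * coordMoment hπ E u k PowerSeries.X := by
  conv_lhs => rw [eq_repr_coordBasis_zero_smul_one_add_repr_one_smul_X hπ E hq u hu γ hreg w hγ r]
  rw [map_add, coordMoment_add, coordMoment_smul_one hπ E hq u hu γ, coordMoment_smul_X hπ E hq u hu γ]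

include hu in
/-- ★ **`mom_0` in the `Λ[Δ]`-basis: `mom_0(r) = c₀(γ − 1) − c₁(γ − 1)`** (`mom_0(1) = 1`): the augmentation of `r` is the `κ`-specialisation of its
`Λ[Δ]`-coordinate (`κ(−1) = −1`). [cite: deShalit1987, Ch. I §3.1, §3.5 (11)] -/
theorem coordMoment_zero_eq_repr_coordBasisDelta (r : ColemanCoordModule hπ hq (algebraMap (LTCoeff F) (unitBall E)) u hu γ) :
    coordMoment hπ E u 0 (TActModule.toPS r) =
      tEval (algebraMap_unit_pow_sub_one_mem hπ E hq γ 0)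
          ((coordBasisDelta hπ hq (algebraMap (LTCoeff F) (unitBall E)) u hu γ hreg w hγ).repr r 0) -
        tEval (algebraMap_unit_pow_sub_one_mem hπ E hq γ 0)
          ((coordBasisDelta hπ hq (algebraMap (LTCoeff F) (unitBall E)) u hu γ hreg w hγ).repr r 1) := by
  rw [coordMoment_eq_repr_coordBasisDelta hπ E hq u hu γ hreg w hγ, coordMoment_zero_one, mul_one]
  ring

include hu in
/-- **Vanishing criterion**: if the `Λ[Δ]`-coordinate of `r` vanishes at the character `κ^{k+1}` — `c₀(a_k) + (−1)^{k+1} c₁(a_k) = 0` — then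
`mom_k(r) = 0`. [cite: deShalit1987, Ch. I §3.5 (11) (ii)] -/
theorem coordMoment_eq_zero_of_repr (k : ℕ) (r : ColemanCoordModule hπ hq (algebraMap (LTCoeff F) (unitBall E)) u hu γ)
    (h : tEval (algebraMap_unit_pow_sub_one_mem hπ E hq γ k)
          ((coordBasisDelta hπ hq (algebraMap (LTCoeff F) (unitBall E)) u hu γ hreg w hγ).repr r 0) +
        (-1) ^ (k + 1) * tEval (algebraMap_unit_pow_sub_one_mem hπ E hq γ k)
          ((coordBasisDelta hπ hq (algebraMap (LTCoeff F) (unitBall E)) u hu γ hreg w hγ).repr r 1) = 0) :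
    coordMoment hπ E u k (TActModule.toPS r) = 0 := by
  rw [coordMoment_eq_repr_coordBasisDelta hπ E hq u hu γ hreg w hγ, h, zero_mul]

include hu in
/-- **Converse at weights where `mom_k(1)` is a non-zero-divisor** (e.g. `k = 0`, `k = 1`): `mom_k(r) = 0` iff the `Λ[Δ]`-coordinate of `r`
vanishes at `κ^{k+1}`. [cite: deShalit1987, Ch. I §3.5 (11) (ii)] -/
theorem coordMoment_eq_zero_iff_repr (k : ℕ) (hk : coordMoment hπ E u k 1 ∈ nonZeroDivisors (unitBall E))
    (r : ColemanCoordModule hπ hq (algebraMap (LTCoeff F) (unitBall E)) u hu γ) :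
    coordMoment hπ E u k (TActModule.toPS r) = 0 ↔
      tEval (algebraMap_unit_pow_sub_one_mem hπ E hq γ k)
          ((coordBasisDelta hπ hq (algebraMap (LTCoeff F) (unitBall E)) u hu γ hreg w hγ).repr r 0) +
        (-1) ^ (k + 1) * tEval (algebraMap_unit_pow_sub_one_mem hπ E hq γ k)
          ((coordBasisDelta hπ hq (algebraMap (LTCoeff F) (unitBall E)) u hu γ hreg w hγ).repr r 1) = 0 := by
  rw [coordMoment_eq_repr_coordBasisDelta hπ E hq u hu γ hreg w hγ]
  exact mul_right_mem_nonZeroDivisors_eq_zero_iff hk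

end CoordMomentsBasisTwo

end Literature.NumberTheory.GaloisRepresentations
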